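import Summits.KontsevichZagierPeriods.Zeta5Search.LaiSweepShard

/-!
# `κ₃` sweep certificate — shard file 076 of 127 (shards 532–538 of 889)

HONEST FRAMING. Systematic search; no irrationality claim unless certified. This file only checks,
by `decide +kernel`, shards 532–538 of the order-cell sweep of the `κ₃` point `(74, 2180, 444; δ74)`
(engine `LaiSweepEngine`, soundness `LaiSweepJump/Free/Eval/Shard/Kappa3`; a shard is `⟨regime, n,
p, q, p', q', Lo, Up⟩`: `n` cells from `p/q` to `p'/q'` with integer rate sums in `[Lo, Up]`, `K =
128`, `D = 2^40`). It draws NO conclusion: only the capstone `LaiKappa3SweepCert`, which needs all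
127 shard files, does. Kernel cost of this file ≈ 560 cells × 0.3 s.
-/

namespace Summit.KontsevichZagierPeriods.Zeta5Search.Sweep

set_option maxHeartbeats 100000000 in
/-- Shard 532: 80 cells of regime B from `156/283` to `179/324`.
[cite: Lai2024BallRivoal, §4 Lemma 4.3] -/
theorem shard532 :
    Shard.check 128 (2^40)
      ⟨true, 80, 156, 283, 179, 324, 13769594115845, 17449628736960⟩ = true := by
  decide +kernel

set_option maxHeartbeats 100000000 in
/-- Shard 533: 80 cells of regime B from `179/324` to `170/307`.
[cite: Lai2024BallRivoal, §4 Lemma 4.3] -/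
theorem shard533 :
    Shard.check 128 (2^40)
      ⟨true, 80, 179, 324, 170, 307, 14232414475052, 18053870055103⟩ = true := by
  decide +kernel

set_option maxHeartbeats 100000000 in
/-- Shard 534: 80 cells of regime B from `170/307` to `106/191`.
[cite: Lai2024BallRivoal, §4 Lemma 4.3] -/
theorem shard534 :
    Shard.check 128 (2^40)
      ⟨true, 80, 170, 307, 106, 191, 13665810219729, 17352096913100⟩ = true := by
  decide +kernel

set_option maxHeartbeats 100000000 in
/-- Shard 535: 80 cells of regime B from `106/191` to `163/293`.
[cite: Lai2024BallRivoal, §4 Lemma 4.3] -/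
theorem shard535 :
    Shard.check 128 (2^40)
      ⟨true, 80, 106, 191, 163, 293, 14890623490234, 18927462804310⟩ = true := by
  decide +kernel

set_option maxHeartbeats 100000000 in
/-- Shard 536: 80 cells of regime B from `163/293` to `63/113`.
[cite: Lai2024BallRivoal, §4 Lemma 4.3] -/
theorem shard536 :
    Shard.check 128 (2^40)
      ⟨true, 80, 163, 293, 63, 113, 13404038788019, 17053984716033⟩ = true := by
  decide +kernel

set_option maxHeartbeats 100000000 in
/-- Shard 537: 80 cells of regime B from `63/113` to `195/349`.
[cite: Lai2024BallRivoal, §4 Lemma 4.3] -/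
theorem shard537 :
    Shard.check 128 (2^40)
      ⟨true, 80, 63, 113, 195, 349, 13495236777819, 17186458189417⟩ = true := by
  decide +kernel

set_option maxHeartbeats 100000000 in
/-- Shard 538: 80 cells of regime B from `195/349` to `205/366`.
[cite: Lai2024BallRivoal, §4 Lemma 4.3] -/
theorem shard538 :
    Shard.check 128 (2^40)
      ⟨true, 80, 195, 349, 205, 366, 15157760569351, 19323589097723⟩ = true := by
  decide +kernel

/-- The checked shards of this file, in order. [folklore] -/
def shards076 : List (CheckedShard 128 (2^40)) :=
  [⟨_, shard532⟩, ⟨_, shard533⟩, ⟨_, shard534⟩, ⟨_, shard535⟩, ⟨_, shard536⟩,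
    ⟨_, shard537⟩, ⟨_, shard538⟩]

end Summit.KontsevichZagierPeriods.Zeta5Search.Sweep
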